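import Summits.NavierStokesRegularity.FunctionalMining.PalinstrophyRefutation
import Literature.Analysis.FluidPDE.NSVorticityOfSmoothRepresentative
import HarnessLib

/-!
# Functional mining: two disjointly supported planted bumps (pinning sieves, part 1 of 3)

Search for candidate a priori estimates; no regularity claim.

Cell `pub-nsfunc` (host summit NavierStokesRegularity, topic `FunctionalMining`), NO-GO branch.
Device file for `NoGo/MonomialBudgetPinning`: two smooth compactly supported fields on `ℝ³` with
DISJOINT supports have additive pointwise densities `‖·‖²`, `Σᵢ‖∂ᵢ·‖²`, `‖Δ·‖²`, `⟪D(·)(·), Δ·⟫`,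
`⟪D(·)(·), Δ²·⟫`, `Σᵢ‖∂ᵢΔ·‖²` (`§ TwoBumps`); the amplified seed `θ U` scales them by `θ²` / `θ³`
(`§ Seed`); the periodisation of two disjoint bumps in the open unit cube is a smooth
divergence-free zero-mean field on `T³` whose six functionals `σ, ℰ, D, K, σ₂, ‖∇Δ·‖₂²` are the
sums of the whole-space integrals (`§ Transfer2`); and the two-bump family member
`periodize (c U(c(· − q)) + 32 (θU)(32(· − q₀)))` has `σ = (c³ + 32³θ³) σ(U)`,
`ℰ = ½ (c + 32 θ²) ‖∇U‖₂²`, `D = (c³ + 32³θ²) D(U)`, `K = ½ (c⁻¹ + 32⁻¹θ²) ‖U‖₂²`,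
`σ₂ = (c⁵ + 32⁵θ³) σ₂(U)`, `‖∇Δ·‖₂² = (c⁵ + 32⁵θ²) ‖∇ΔU‖₂²` (`twoBump_facts`). No definitions, no
claim about Navier–Stokes in this file. Devices used: `QuadraticBudgetPlanting`,
`MonomialBudgetRefutation`, `PalinstrophyRefutation` (planting/transfer lemmas).
FILING (prove seat g34, REQUEST #133): declarations byte-identical to the no-go seat's staged `MonomialBudgetPinningBumps.STAGING.lean` 98b95a2a44645d5b; this line is the only addition.
-/

noncomputable section

open MeasureTheory Set Filter Topology InnerProductSpace Metric
open scoped RealInnerProductSpace Laplacian ContDiff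

namespace Summit.NavierStokesRegularity.FunctionalMining

open Literature.Analysis.FunctionSpaces Literature.Analysis.FluidPDE

/-! ## Two disjointly supported fields on `ℝ³`: the functionals add -/

section TwoBumps

variable {g₁ g₂ : EuclideanSpace ℝ (Fin 3) → EuclideanSpace ℝ (Fin 3)}

/-- A continuous real function vanishing off a compact set is integrable. [folklore] -/
theorem integrable_of_eq_zero_off_compact {φ : EuclideanSpace ℝ (Fin 3) → ℝ} (hφ : Continuous φ)
    {K : Set (EuclideanSpace ℝ (Fin 3))} (hK : IsCompact K) (h : ∀ z, z ∉ K → φ z = 0) :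
    Integrable φ :=
  hφ.integrable_of_hasCompactSupport
    (HasCompactSupport.of_support_subset_isCompact hK fun z hz => by
      by_contra hzK
      exact Function.mem_support.1 hz (h z hzK))

/-- `z ↦ ‖g z‖²` is integrable for `g` smooth with compact support. [folklore] -/
theorem integrable_normSq (hg : ContDiff ℝ ∞ g₁) (hgc : HasCompactSupport g₁) :
    Integrable (fun z => ‖g₁ z‖ ^ 2) :=
  integrable_of_eq_zero_off_compact (hg.continuous.norm.pow 2) hgc fun z hz => by
    simp [image_eq_zero_of_notMem_tsupport hz]

/-- `z ↦ Σᵢ ‖∂ᵢ g(z)‖²` is integrable for `g` smooth with compact support. [folklore] -/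
theorem integrable_gradNormSq (hg : ContDiff ℝ ∞ g₁) (hgc : HasCompactSupport g₁) :
    Integrable (fun z => ∑ i, ‖fderiv ℝ g₁ z (EuclideanSpace.single i 1)‖ ^ 2) :=
  integrable_of_eq_zero_off_compact
    (continuous_finsetSum _ fun i _ =>
      (((hg.continuous_fderiv (by simp)).clm_apply continuous_const).norm.pow 2))
    hgc fun z hz => by simp [fderiv_of_notMem_tsupport ℝ hz]

/-- `z ↦ ‖Δg(z)‖²` is integrable for `g` smooth with compact support. [folklore] -/
theorem integrable_laplacianNormSq (hg : ContDiff ℝ ∞ g₁) (hgc : HasCompactSupport g₁) :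
    Integrable (fun z => ‖Δ g₁ z‖ ^ 2) :=
  integrable_of_eq_zero_off_compact
    ((BumpWitness.contDiff_laplacian_of_smooth hg).continuous.norm.pow 2) hgc fun z hz => by
    simp [laplacian_eq_zero_of_notMem_tsupport hz]

/-- `Δ(g₁ + g₂) = Δg₁ + Δg₂` pointwise for smooth fields. [folklore] -/
theorem laplacian_add_of_smooth (h₁ : ContDiff ℝ ∞ g₁) (h₂ : ContDiff ℝ ∞ g₂)
    (z : EuclideanSpace ℝ (Fin 3)) : Δ (fun y => g₁ y + g₂ y) z = Δ g₁ z + Δ g₂ z :=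
  (h₁.contDiffAt.of_le (WithTop.coe_le_coe.mpr le_top)).laplacian_add
    (h₂.contDiffAt.of_le (WithTop.coe_le_coe.mpr le_top))

/-- `Δ(g₁ + g₂) = Δg₁ + Δg₂` as functions, for smooth fields. [folklore] -/
theorem laplacian_add_fun_of_smooth (h₁ : ContDiff ℝ ∞ g₁) (h₂ : ContDiff ℝ ∞ g₂) :
    Δ (fun y => g₁ y + g₂ y) = fun z => Δ g₁ z + Δ g₂ z :=
  funext (laplacian_add_of_smooth h₁ h₂)

variable (hd : ∀ z, z ∉ tsupport g₁ ∨ z ∉ tsupport g₂)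
include hd

/-- Disjoint supports: `‖g₁ + g₂‖² = ‖g₁‖² + ‖g₂‖²` pointwise. [folklore] -/
theorem normSq_add_of_disjoint (z : EuclideanSpace ℝ (Fin 3)) :
    ‖g₁ z + g₂ z‖ ^ 2 = ‖g₁ z‖ ^ 2 + ‖g₂ z‖ ^ 2 := by
  rcases hd z with hz | hz <;> simp [image_eq_zero_of_notMem_tsupport hz]

/-- Disjoint supports: `Σᵢ‖∂ᵢ(g₁ + g₂)‖² = Σᵢ‖∂ᵢg₁‖² + Σᵢ‖∂ᵢg₂‖²` pointwise. [folklore] -/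
theorem gradNormSq_add_of_disjoint (h₁ : ContDiff ℝ ∞ g₁) (h₂ : ContDiff ℝ ∞ g₂)
    (z : EuclideanSpace ℝ (Fin 3)) :
    (∑ i, ‖fderiv ℝ (fun y => g₁ y + g₂ y) z (EuclideanSpace.single i 1)‖ ^ 2) =
      (∑ i, ‖fderiv ℝ g₁ z (EuclideanSpace.single i 1)‖ ^ 2) +
        ∑ i, ‖fderiv ℝ g₂ z (EuclideanSpace.single i 1)‖ ^ 2 := by
  rw [fderiv_fun_add ((h₁.differentiable (by simp)).differentiableAt)
    ((h₂.differentiable (by simp)).differentiableAt)]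
  rcases hd z with hz | hz <;> simp [fderiv_of_notMem_tsupport ℝ hz]

/-- Disjoint supports: `‖Δ(g₁ + g₂)‖² = ‖Δg₁‖² + ‖Δg₂‖²` pointwise. [folklore] -/
theorem laplacianNormSq_add_of_disjoint (h₁ : ContDiff ℝ ∞ g₁) (h₂ : ContDiff ℝ ∞ g₂)
    (z : EuclideanSpace ℝ (Fin 3)) :
    ‖Δ (fun y => g₁ y + g₂ y) z‖ ^ 2 = ‖Δ g₁ z‖ ^ 2 + ‖Δ g₂ z‖ ^ 2 := by
  rw [laplacian_add_of_smooth h₁ h₂ z]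
  rcases hd z with hz | hz <;> simp [laplacian_eq_zero_of_notMem_tsupport hz]

/-- Disjoint supports: `⟪D(g₁+g₂)(g₁+g₂), Δ(g₁+g₂)⟫` is the sum of the two integrands. [folklore] -/
theorem productionIntegrand_add_of_disjoint (h₁ : ContDiff ℝ ∞ g₁) (h₂ : ContDiff ℝ ∞ g₂)
    (z : EuclideanSpace ℝ (Fin 3)) :
    ⟪fderiv ℝ (fun y => g₁ y + g₂ y) z (g₁ z + g₂ z), Δ (fun y => g₁ y + g₂ y) z⟫ =
      ⟪fderiv ℝ g₁ z (g₁ z), Δ g₁ z⟫ + ⟪fderiv ℝ g₂ z (g₂ z), Δ g₂ z⟫ := by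
  rw [fderiv_fun_add ((h₁.differentiable (by simp)).differentiableAt)
    ((h₂.differentiable (by simp)).differentiableAt), laplacian_add_of_smooth h₁ h₂ z]
  rcases hd z with hz | hz <;>
    simp [image_eq_zero_of_notMem_tsupport hz, fderiv_of_notMem_tsupport ℝ hz,
      laplacian_eq_zero_of_notMem_tsupport hz]

/-- Disjoint supports: `⟪D(g₁+g₂)(g₁+g₂), Δ²(g₁+g₂)⟫` is the sum of the integrands. [folklore] -/
theorem production2Integrand_add_of_disjoint (h₁ : ContDiff ℝ ∞ g₁) (h₂ : ContDiff ℝ ∞ g₂)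
    (z : EuclideanSpace ℝ (Fin 3)) :
    ⟪fderiv ℝ (fun y => g₁ y + g₂ y) z (g₁ z + g₂ z), Δ (Δ (fun y => g₁ y + g₂ y)) z⟫ =
      ⟪fderiv ℝ g₁ z (g₁ z), Δ (Δ g₁) z⟫ + ⟪fderiv ℝ g₂ z (g₂ z), Δ (Δ g₂) z⟫ := by
  have hΔ₁ := BumpWitness.contDiff_laplacian_of_smooth h₁
  have hΔ₂ := BumpWitness.contDiff_laplacian_of_smooth h₂
  rw [fderiv_fun_add ((h₁.differentiable (by simp)).differentiableAt)
    ((h₂.differentiable (by simp)).differentiableAt), laplacian_add_fun_of_smooth h₁ h₂,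
    laplacian_add_of_smooth hΔ₁ hΔ₂ z]
  rcases hd z with hz | hz
  · simp [image_eq_zero_of_notMem_tsupport hz, fderiv_of_notMem_tsupport ℝ hz,
      laplacian_eq_zero_of_notMem_tsupport fun h => hz (tsupport_laplacian_subset g₁ h)]
  · simp [image_eq_zero_of_notMem_tsupport hz, fderiv_of_notMem_tsupport ℝ hz,
      laplacian_eq_zero_of_notMem_tsupport fun h => hz (tsupport_laplacian_subset g₂ h)]

/-- Disjoint supports: `Σᵢ‖∂ᵢΔ(g₁ + g₂)‖² = Σᵢ‖∂ᵢΔg₁‖² + Σᵢ‖∂ᵢΔg₂‖²` pointwise. [folklore] -/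
theorem gradNormSq_laplacian_add_of_disjoint (h₁ : ContDiff ℝ ∞ g₁) (h₂ : ContDiff ℝ ∞ g₂)
    (z : EuclideanSpace ℝ (Fin 3)) :
    (∑ i, ‖fderiv ℝ (Δ (fun y => g₁ y + g₂ y)) z (EuclideanSpace.single i 1)‖ ^ 2) =
      (∑ i, ‖fderiv ℝ (Δ g₁) z (EuclideanSpace.single i 1)‖ ^ 2) +
        ∑ i, ‖fderiv ℝ (Δ g₂) z (EuclideanSpace.single i 1)‖ ^ 2 := by
  have hΔ₁ := BumpWitness.contDiff_laplacian_of_smooth h₁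
  have hΔ₂ := BumpWitness.contDiff_laplacian_of_smooth h₂
  rw [laplacian_add_fun_of_smooth h₁ h₂]
  exact gradNormSq_add_of_disjoint
    (fun z => (hd z).imp (fun h h' => h (tsupport_laplacian_subset g₁ h'))
      fun h h' => h (tsupport_laplacian_subset g₂ h')) hΔ₁ hΔ₂ z

end TwoBumps

/-! ## The amplified seed `θ U` on `ℝ³` -/

section Seed

variable {U V : EuclideanSpace ℝ (Fin 3) → EuclideanSpace ℝ (Fin 3)} {θ : ℝ}

/-- `θ U` is smooth. [folklore] -/
theorem seed_contDiff (hU : ContDiff ℝ ∞ U) (hV : ∀ z, V z = θ • U z) : ContDiff ℝ ∞ V := by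
  rw [show V = fun z => θ • U z from funext hV]
  exact hU.const_smul θ

/-- `supp (θ U) ⊆ supp U`. [folklore] -/
theorem seed_tsupport (hV : ∀ z, V z = θ • U z) : tsupport V ⊆ tsupport U :=
  closure_mono fun z hz => Function.mem_support.2 fun h =>
    Function.mem_support.1 hz (by rw [hV z, h, smul_zero])

/-- `D(θ U) = θ DU`. [folklore] -/
theorem seed_fderiv (hU : ContDiff ℝ ∞ U) (hV : ∀ z, V z = θ • U z)
    (z : EuclideanSpace ℝ (Fin 3)) : fderiv ℝ V z = θ • fderiv ℝ U z := by
  rw [show V = fun z => θ • U z from funext hV]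
  exact fderiv_fun_const_smul ((hU.differentiable (by simp)).differentiableAt) θ

/-- `Δ(θ U) = θ ΔU`. [folklore] -/
theorem seed_laplacian (hU : ContDiff ℝ ∞ U) (hV : ∀ z, V z = θ • U z) :
    Δ V = fun z => θ • Δ U z := by
  funext z
  rw [show V = θ • U from funext hV]
  exact InnerProductSpace.laplacian_smul θ (hU.contDiffAt.of_le (WithTop.coe_le_coe.mpr le_top))

/-- `Δ²(θ U) = θ Δ²U`. [folklore] -/
theorem seed_laplacian_laplacian (hU : ContDiff ℝ ∞ U) (hV : ∀ z, V z = θ • U z) :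
    Δ (Δ V) = fun z => θ • Δ (Δ U) z := by
  rw [seed_laplacian hU hV]
  exact seed_laplacian (BumpWitness.contDiff_laplacian_of_smooth hU) fun _ => rfl

/-- `θ U` is divergence free if `U` is. [folklore] -/
theorem seed_divergence (hU : ContDiff ℝ ∞ U) (hdiv : ∀ y, VectorCalculus.divergence U y = 0)
    (hV : ∀ z, V z = θ • U z) (y : EuclideanSpace ℝ (Fin 3)) :
    VectorCalculus.divergence V y = 0 := by
  have h := hdiv y
  unfold VectorCalculus.divergence at h ⊢
  rw [seed_fderiv hU hV y, ContinuousLinearMap.toLinearMap_smul, map_smul, h, smul_zero]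

/-- `∫‖θ U‖² = θ² ∫‖U‖²`. [folklore] -/
theorem seed_normSq (hV : ∀ z, V z = θ • U z) :
    (∫ z, ‖V z‖ ^ 2) = θ ^ 2 * ∫ z, ‖U z‖ ^ 2 := by
  have hpt : ∀ z, ‖V z‖ ^ 2 = θ ^ 2 * ‖U z‖ ^ 2 := fun z => by
    rw [hV z, norm_smul, mul_pow, Real.norm_eq_abs, sq_abs]
  rw [integral_congr_ae (ae_of_all _ hpt), integral_const_mul]

/-- `∫ Σᵢ‖∂ᵢ(θ U)‖² = θ² ∫ Σᵢ‖∂ᵢU‖²`. [folklore] -/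
theorem seed_gradNormSq (hU : ContDiff ℝ ∞ U) (hV : ∀ z, V z = θ • U z) :
    (∫ z, ∑ i, ‖fderiv ℝ V z (EuclideanSpace.single i 1)‖ ^ 2) =
      θ ^ 2 * ∫ z, ∑ i, ‖fderiv ℝ U z (EuclideanSpace.single i 1)‖ ^ 2 := by
  have hpt : ∀ z, (∑ i, ‖fderiv ℝ V z (EuclideanSpace.single i 1)‖ ^ 2) =
      θ ^ 2 * ∑ i, ‖fderiv ℝ U z (EuclideanSpace.single i 1)‖ ^ 2 := fun z => by
    rw [seed_fderiv hU hV z, Finset.mul_sum]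
    refine Finset.sum_congr rfl fun i _ => ?_
    rw [FunLike.coe_smul, Pi.smul_apply, norm_smul, mul_pow, Real.norm_eq_abs,
      sq_abs]
  rw [integral_congr_ae (ae_of_all _ hpt), integral_const_mul]

/-- `∫‖Δ(θ U)‖² = θ² ∫‖ΔU‖²`. [folklore] -/
theorem seed_laplacianNormSq (hU : ContDiff ℝ ∞ U) (hV : ∀ z, V z = θ • U z) :
    (∫ z, ‖Δ V z‖ ^ 2) = θ ^ 2 * ∫ z, ‖Δ U z‖ ^ 2 :=
  seed_normSq (congrFun (seed_laplacian hU hV))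

/-- `∫ Σᵢ‖∂ᵢΔ(θ U)‖² = θ² ∫ Σᵢ‖∂ᵢΔU‖²`. [folklore] -/
theorem seed_gradNormSq_laplacian (hU : ContDiff ℝ ∞ U) (hV : ∀ z, V z = θ • U z) :
    (∫ z, ∑ i, ‖fderiv ℝ (Δ V) z (EuclideanSpace.single i 1)‖ ^ 2) =
      θ ^ 2 * ∫ z, ∑ i, ‖fderiv ℝ (Δ U) z (EuclideanSpace.single i 1)‖ ^ 2 :=
  seed_gradNormSq (BumpWitness.contDiff_laplacian_of_smooth hU) (congrFun (seed_laplacian hU hV))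

/-- `σ(θ U) = θ³ σ(U)`. [folklore] -/
theorem seed_production (hU : ContDiff ℝ ∞ U) (hV : ∀ z, V z = θ • U z) :
    (∫ z, ⟪fderiv ℝ V z (V z), Δ V z⟫) = θ ^ 3 * ∫ z, ⟪fderiv ℝ U z (U z), Δ U z⟫ := by
  have hpt : ∀ z, ⟪fderiv ℝ V z (V z), Δ V z⟫ = θ ^ 3 * ⟪fderiv ℝ U z (U z), Δ U z⟫ := fun z => by
    rw [seed_fderiv hU hV z, hV z, seed_laplacian hU hV]
    simp only [FunLike.coe_smul, Pi.smul_apply, map_smul, real_inner_smul_left,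
      real_inner_smul_right]
    ring
  rw [integral_congr_ae (ae_of_all _ hpt), integral_const_mul]

/-- `σ₂(θ U) = θ³ σ₂(U)`. [folklore] -/
theorem seed_production2 (hU : ContDiff ℝ ∞ U) (hV : ∀ z, V z = θ • U z) :
    (∫ z, ⟪fderiv ℝ V z (V z), Δ (Δ V) z⟫) =
      θ ^ 3 * ∫ z, ⟪fderiv ℝ U z (U z), Δ (Δ U) z⟫ := by
  have hpt : ∀ z, ⟪fderiv ℝ V z (V z), Δ (Δ V) z⟫ =
      θ ^ 3 * ⟪fderiv ℝ U z (U z), Δ (Δ U) z⟫ := fun z => by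
    rw [seed_fderiv hU hV z, hV z, seed_laplacian_laplacian hU hV]
    simp only [FunLike.coe_smul, Pi.smul_apply, map_smul, real_inner_smul_left,
      real_inner_smul_right]
    ring
  rw [integral_congr_ae (ae_of_all _ hpt), integral_const_mul]

end Seed

/-! ## Two planted bumps: transfer to `T³` -/

section Transfer2

variable {P L : EuclideanSpace ℝ (Fin 3) → EuclideanSpace ℝ (Fin 3)}

/-- **Two disjoint bumps in the period cell.** For smooth compactly supported divergence-free
fields `P, L` on `ℝ³` with disjoint supports inside the open unit cube, the periodisation of
`P + L` is a smooth divergence-free zero-mean field on `T³` and each of the six functionals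
`σ, ℰ, D, K, σ₂, ‖∇Δ·‖₂²` of it is the sum of the corresponding whole-space integrals of `P` and of
`L`. [folklore] -/
theorem twoBump_periodize_facts (hP : ContDiff ℝ ∞ P) (hL : ContDiff ℝ ∞ L)
    (hPc : HasCompactSupport P) (hLc : HasCompactSupport L)
    (hPs : tsupport P ⊆ {y | ∀ i, y i ∈ Ioo (0 : ℝ) 1})
    (hLs : tsupport L ⊆ {y | ∀ i, y i ∈ Ioo (0 : ℝ) 1})
    (hd : ∀ z, z ∉ tsupport P ∨ z ∉ tsupport L)
    (hPdiv : ∀ z, LinearMap.trace ℝ _ (fderiv ℝ P z : EuclideanSpace ℝ (Fin 3) →ₗ[ℝ]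
      EuclideanSpace ℝ (Fin 3)) = 0)
    (hLdiv : ∀ z, LinearMap.trace ℝ _ (fderiv ℝ L z : EuclideanSpace ℝ (Fin 3) →ₗ[ℝ]
      EuclideanSpace ℝ (Fin 3)) = 0) :
    Torus.IsSmooth (Torus.periodize fun y => P y + L y) ∧
    Torus.IsDivFree (Torus.periodize fun y => P y + L y) ∧
    Torus.HasZeroMean (Torus.periodize fun y => P y + L y) ∧
    enstrophyProduction (Torus.periodize fun y => P y + L y) =
      (∫ z, ⟪fderiv ℝ P z (P z), Δ P z⟫) + ∫ z, ⟪fderiv ℝ L z (L z), Δ L z⟫ ∧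
    torusEnstrophy (Torus.periodize fun y => P y + L y) =
      2⁻¹ * ((∫ z, ∑ i, ‖fderiv ℝ P z (EuclideanSpace.single i 1)‖ ^ 2) +
        ∫ z, ∑ i, ‖fderiv ℝ L z (EuclideanSpace.single i 1)‖ ^ 2) ∧
    (∫ x, ‖Torus.laplacian (Torus.periodize fun y => P y + L y) x‖ ^ 2) =
      (∫ z, ‖Δ P z‖ ^ 2) + ∫ z, ‖Δ L z‖ ^ 2 ∧
    Torus.kineticEnergy (Torus.periodize fun y => P y + L y) =
      2⁻¹ * ((∫ z, ‖P z‖ ^ 2) + ∫ z, ‖L z‖ ^ 2) ∧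
    (∫ x, ⟪Torus.convect (Torus.periodize fun y => P y + L y) (Torus.periodize fun y => P y + L y)
        x, Torus.laplacian (Torus.laplacian (Torus.periodize fun y => P y + L y)) x⟫) =
      (∫ z, ⟪fderiv ℝ P z (P z), Δ (Δ P) z⟫) + ∫ z, ⟪fderiv ℝ L z (L z), Δ (Δ L) z⟫ ∧
    Torus.gradNormSq (Torus.laplacian (Torus.periodize fun y => P y + L y)) =
      (∫ z, ∑ i, ‖fderiv ℝ (Δ P) z (EuclideanSpace.single i 1)‖ ^ 2) +
        ∫ z, ∑ i, ‖fderiv ℝ (Δ L) z (EuclideanSpace.single i 1)‖ ^ 2 := by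
  have two : (2 : WithTop ℕ∞) ≤ ∞ := WithTop.coe_le_coe.mpr le_top
  have hg : ContDiff ℝ ∞ (fun y => P y + L y) := hP.add hL
  have hgc : HasCompactSupport (fun y => P y + L y) := hPc.add hLc
  have hgs : tsupport (fun y => P y + L y) ⊆ {y | ∀ i, y i ∈ Ioo (0 : ℝ) 1} :=
    (tsupport_add P L).trans (union_subset hPs hLs)
  have hgdiv : ∀ z, LinearMap.trace ℝ _ (fderiv ℝ (fun y => P y + L y) z :
      EuclideanSpace ℝ (Fin 3) →ₗ[ℝ] EuclideanSpace ℝ (Fin 3)) = 0 := fun z => by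
    rw [fderiv_fun_add ((hP.differentiable (by simp)).differentiableAt)
      ((hL.differentiable (by simp)).differentiableAt), ContinuousLinearMap.toLinearMap_add,
      map_add, hPdiv z, hLdiv z, add_zero]
  have hΔP := BumpWitness.contDiff_laplacian_of_smooth hP
  have hΔL := BumpWitness.contDiff_laplacian_of_smooth hL
  have hΔPc := BumpWitness.hasCompactSupport_laplacian hPc
  have hΔLc := BumpWitness.hasCompactSupport_laplacian hLc
  obtain ⟨hsm, hdf, hzm⟩ := periodize_smooth_divFree_zeroMean hg hgc hgs hgdiv
  refine ⟨hsm, hdf, hzm, ?_, ?_, ?_, ?_, ?_, ?_⟩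
  · rw [enstrophyProduction_periodize hg hgs,
      integral_congr_ae (ae_of_all _ (productionIntegrand_add_of_disjoint hd hP hL)),
      integral_add (BumpWitness.integrable_inner_fderiv_laplacian (hP.of_le two) hP.continuous
        (hP.of_le two) hPc) (BumpWitness.integrable_inner_fderiv_laplacian (hL.of_le two)
        hL.continuous (hL.of_le two) hLc)]
  · rw [torusEnstrophy_periodize hg hgs,
      integral_congr_ae (ae_of_all _ (gradNormSq_add_of_disjoint hd hP hL)),
      integral_add (integrable_gradNormSq hP hPc) (integrable_gradNormSq hL hLc)]
  · rw [laplacianNormSq_periodize hg hgs,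
      integral_congr_ae (ae_of_all _ (laplacianNormSq_add_of_disjoint hd hP hL)),
      integral_add (integrable_laplacianNormSq hP hPc) (integrable_laplacianNormSq hL hLc)]
  · rw [kineticEnergy_periodize hgs, integral_congr_ae (ae_of_all _ (normSq_add_of_disjoint hd)),
      integral_add (integrable_normSq hP hPc) (integrable_normSq hL hLc)]
  · rw [production2_periodize hg hgs,
      integral_congr_ae (ae_of_all _ (production2Integrand_add_of_disjoint hd hP hL)),
      integral_add (BumpWitness.integrable_inner_fderiv_laplacian (hP.of_le two) hP.continuous
        (hΔP.of_le two) hΔPc) (BumpWitness.integrable_inner_fderiv_laplacian (hL.of_le two)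
        hL.continuous (hΔL.of_le two) hΔLc)]
  · rw [gradNormSq_laplacian_periodize hg hgs,
      integral_congr_ae (ae_of_all _ (gradNormSq_laplacian_add_of_disjoint hd hP hL)),
      integral_add (integrable_gradNormSq hΔP hΔPc) (integrable_gradNormSq hΔL hΔLc)]

end Transfer2

/-! ## The two-bump family member: the six functionals -/

section Family

variable {U V : EuclideanSpace ℝ (Fin 3) → EuclideanSpace ℝ (Fin 3)} {c θ : ℝ}
  {q q₀ : EuclideanSpace ℝ (Fin 3)}

/-- **The two-bump family member.** For the seed `U` (smooth, supported in `B̄(0,2)`, divergence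
free), an amplitude `θ` (`V = θ U`) and a scale `c ≥ 16`, if the two planted bumps sit in the open
unit cube with disjoint supports (`NoGo/MonomialBudgetPinningBounds`: `packet_tsupport_cube`,
`low_tsupport_cube`, `packet_low_disjoint` for `q = (½,½,½)`, `q₀ = (3/16,3/16,3/16)`), the field
`w = periodize (c U(c(· − q)) + 32 V(32(· − q₀)))` is a smooth divergence-free zero-mean field on
`T³` with `σ(w) = (c³ + 32³θ³) σ(U)`, `ℰ(w) = ½ (c + 32 θ²) ‖∇U‖₂²`, `D(w) = (c³ + 32³θ²) D(U)`,
`K(w) = ½ (c⁻¹ + 32⁻¹θ²) ‖U‖₂²`, `σ₂(w) = (c⁵ + 32⁵θ³) σ₂(U)`, `‖∇Δw‖₂² = (c⁵ + 32⁵θ²) ‖∇ΔU‖₂²`.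
[folklore] -/
theorem twoBump_facts (hU : ContDiff ℝ ∞ U) (hUs : tsupport U ⊆ closedBall 0 2)
    (hdiv : ∀ y, VectorCalculus.divergence U y = 0) (hV : ∀ z, V z = θ • U z) (hc : 16 ≤ c)
    (hPs : tsupport (fun y => c • U (c • (y + -q))) ⊆ {y | ∀ i, y i ∈ Ioo (0 : ℝ) 1})
    (hLs : tsupport (fun y => (32 : ℝ) • V ((32 : ℝ) • (y + -q₀))) ⊆
      {y | ∀ i, y i ∈ Ioo (0 : ℝ) 1})
    (hd : ∀ z, z ∉ tsupport (fun y => c • U (c • (y + -q))) ∨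
      z ∉ tsupport (fun y => (32 : ℝ) • V ((32 : ℝ) • (y + -q₀))))
    {w : UnitAddTorus (Fin 3) → EuclideanSpace ℝ (Fin 3)}
    (hw : w = Torus.periodize fun y =>
      c • U (c • (y + -q)) + (32 : ℝ) • V ((32 : ℝ) • (y + -q₀))) :
    Torus.IsSmooth w ∧ Torus.IsDivFree w ∧ Torus.HasZeroMean w ∧
    enstrophyProduction w = (c ^ 3 + 32 ^ 3 * θ ^ 3) * ∫ z, ⟪fderiv ℝ U z (U z), Δ U z⟫ ∧
    torusEnstrophy w =
      2⁻¹ * ((c + 32 * θ ^ 2) * ∫ z, ∑ i, ‖fderiv ℝ U z (EuclideanSpace.single i 1)‖ ^ 2) ∧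
    (∫ x, ‖Torus.laplacian w x‖ ^ 2) = (c ^ 3 + 32 ^ 3 * θ ^ 2) * ∫ z, ‖Δ U z‖ ^ 2 ∧
    Torus.kineticEnergy w = 2⁻¹ * ((c⁻¹ + 32⁻¹ * θ ^ 2) * ∫ z, ‖U z‖ ^ 2) ∧
    (∫ x, ⟪Torus.convect w w x, Torus.laplacian (Torus.laplacian w) x⟫) =
      (c ^ 5 + 32 ^ 5 * θ ^ 3) * ∫ z, ⟪fderiv ℝ U z (U z), Δ (Δ U) z⟫ ∧
    Torus.gradNormSq (Torus.laplacian w) =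
      (c ^ 5 + 32 ^ 5 * θ ^ 2) * ∫ z, ∑ i, ‖fderiv ℝ (Δ U) z (EuclideanSpace.single i 1)‖ ^ 2 := by
  subst hw
  have hc0 : 0 < c := by linarith
  have h32 : (0 : ℝ) < 32 := by norm_num
  have hUc : HasCompactSupport U :=
    HasCompactSupport.of_support_subset_isCompact (isCompact_closedBall 0 2)
      (subset_closure.trans hUs)
  have hVC : ContDiff ℝ ∞ V := seed_contDiff hU hV
  have hVc : HasCompactSupport V :=
    HasCompactSupport.of_support_subset_isCompact (isCompact_closedBall 0 2)
      (subset_closure.trans ((seed_tsupport hV).trans hUs))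
  have hVdiv : ∀ y, VectorCalculus.divergence V y = 0 := seed_divergence hU hdiv hV
  obtain ⟨hsm, hdf, hzm, h1, h2, h3, h4, h5, h6⟩ := twoBump_periodize_facts
    (P := fun y => c • U (c • (y + -q))) (L := fun y => (32 : ℝ) • V ((32 : ℝ) • (y + -q₀)))
    (contDiff_plant hU c (-q)) (contDiff_plant hVC 32 (-q₀))
    (hasCompactSupport_plant hc0 hUc (-q)) (hasCompactSupport_plant h32 hVc (-q₀))
    hPs hLs hd
    (trace_fderiv_plant hc0.ne' hdiv (-q)) (trace_fderiv_plant h32.ne' hVdiv (-q₀))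
  refine ⟨hsm, hdf, hzm, ?_, ?_, ?_, ?_, ?_, ?_⟩
  · rw [h1, production_plant U hc0 (-q), production_plant V h32 (-q₀), seed_production hU hV]
    ring
  · rw [h2, gradNormSq_plant U hc0 (-q), gradNormSq_plant V h32 (-q₀), seed_gradNormSq hU hV]
    ring
  · rw [h3, laplacianNormSq_plant U hc0 (-q), laplacianNormSq_plant V h32 (-q₀),
      seed_laplacianNormSq hU hV]
    ring
  · rw [h4, normSq_plant U hc0 (-q), normSq_plant V h32 (-q₀), seed_normSq hV]
    ring
  · rw [h5, production2_plant U hc0 (-q), production2_plant V h32 (-q₀), seed_production2 hU hV]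
    ring
  · rw [h6, gradNormSq_laplacian_plant U hc0 (-q), gradNormSq_laplacian_plant V h32 (-q₀),
      seed_gradNormSq_laplacian hU hV]
    ring

end Family

end Summit.NavierStokesRegularity.FunctionalMining
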